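import Summits.AnomalousDissipation.AnomalousDissipation.Theorems.BaireTransferDenseLoudDesignerForcesErgodicLine
import Literature.Analysis.FluidPDE.StokesTorusResolvent

/-!
# The smoothing isomorphism `(1 + A)⁻¹` on `H` (line `ergodic-budget-selection-closing`,
# crux `BaireTransfer.DenseLoudDesignerForces`, stmt-AnomalousDissipation-1143) — tools stub of block N

Sorry-free file over the landed vocabulary `…ErgodicLine.lean` (`Hsp = Torus.energySpace (Fin 3)`) and the landed
Stokes resolvent on the torus energy space (`Literature/Analysis/FluidPDE/StokesTorusResolvent.lean`:
`Torus.exists_stokesResolvent d`).  Block N of the line conjugates the Navier–Stokes strong-solution semiflow by the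
smoothing isomorphism `Smap := (1 + A)⁻¹ : H → D(A)` (`A = Torus.stokesOperatorH (Fin 3)`, the Stokes operator on the
mean-zero solenoidal energy space; Constantin–Foias 1988, Ch. 4) so that it becomes a smooth local semiflow on an open
subset of `H`; this file supplies `Smap` with exactly the properties the model consumes:

* `stub_stokesResolventTools` (the REGISTERED tools stub, proved) — there is `R : H →L[ℝ] H`, injective, of norm `≤ 1`,
  self-adjoint and compact, with `R v ∈ D(A)` and `R v + A (R v) = v` for every `v ∈ H`, and `R (v + A v) = v` for every
  `v ∈ D(A)` (the case `d = Fin 3` of `Torus.exists_stokesResolvent`).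

References: P. Constantin, C. Foias, *Navier–Stokes Equations* (Univ. Chicago Press 1988), Ch. 4, (4.4)–(4.7),
(4.11)–(4.13); M. Reed, B. Simon, *Methods of Modern Mathematical Physics I* (1980), §VIII.3.  Nothing is asserted; no
definition is added.
-/

-- `Summit.<Summit>.<Problem>` is the tree's mandated summit-side namespace (CONVENTIONS §2); for this
-- single-conjunct summit the two coincide, so the duplicate is deliberate.
set_option linter.dupNamespace false

noncomputable section

namespace Summit.AnomalousDissipation.AnomalousDissipation.Theorems.DenseLoudDesignerForces.Ergodic

open Literature.Analysis.FunctionSpaces Literature.Analysis.FunctionSpaces.Torus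
open Literature.Analysis.FluidPDE Literature.Analysis.FluidPDE.Torus

/-- **Tools stub N0d — the smoothing isomorphism `Smap = (1 + A)⁻¹` on `H`.**  With `A` the Stokes operator on the energy
space (`Torus.stokesOperatorH (Fin 3)`, self-adjoint, positive, diagonal in the Stokes eigenbasis with eigenvalues
`4π²|k|² → ∞`: `exists_hilbertBasis_stokes_holds`), the resolvent `R := (1 + A)⁻¹` is an injective self-adjoint compact
contraction of `H` mapping `H` into the domain `D(A)` with `(1 + A) R = 1` on `H` and `R (1 + A) = 1` on `D(A)`
(Constantin–Foias 1988 Ch. 4 (4.4)–(4.7), (4.11)–(4.13); the tree's `Torus.exists_stokesResolvent` at `d = Fin 3`).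
[cite: ConstantinFoiasNSE1988, Ch. 4 (the Stokes operator, (4.11)–(4.13))] -/
theorem stub_stokesResolventTools :
    ∃ R : Hsp →L[ℝ] Hsp, Function.Injective R ∧ ‖R‖ ≤ 1 ∧ IsSelfAdjoint R ∧ IsCompactOperator R ∧
      (∀ v : Hsp, ∃ hv : R v ∈ (stokesOperatorH (Fin 3)).domain, R v + stokesOperatorH (Fin 3) ⟨R v, hv⟩ = v) ∧
      (∀ (v : Hsp) (hv : v ∈ (stokesOperatorH (Fin 3)).domain), R (v + stokesOperatorH (Fin 3) ⟨v, hv⟩) = v) :=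
  exists_stokesResolvent (Fin 3)

end Summit.AnomalousDissipation.AnomalousDissipation.Theorems.DenseLoudDesignerForces.Ergodic
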